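import Literature.RepresentationTheory.VerySimpleMinimalProjectiveDegree
import HarnessLib

/-!
# Corollary 4.4 of Zarhin 2002 at the strength of its printed proof: no perfectness hypothesis

Topic `Literature/RepresentationTheory`, namespace `Literature.RepresentationTheory`; lane `lit-hodgefound`
(Track 2 foundations library), row g15-#2 «(g15-#1 `VerySimpleMinimalProjectiveDegree`)⁺ — Zarhin 2002
MMJ §4 COROLLARY 4.4 AT THE STRENGTH OF ITS PRINTED PROOF, i.e. WITHOUT HYPOTHESIS (i)» of seat p11
(gen 15). THEOREMS ONLY (no definition, no named fact; net debt 0). Sequel of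
`VerySimpleMinimalProjectiveDegree.lean` (g15-#1: Proposition 3.2 (a)(b)(c), Corollary 4.4 and [183]
Example 2.3 with hypothesis (i) "`G` is perfect" as printed in the statements).

## Source READ (held text), verbatim

Yu. G. Zarhin, *Very simple 2-adic representations and hyperelliptic Jacobians*, Mosc. Math. J. 2
(2002) 403–431 (bib `Zarhin2002VerySimple`; held text `paper:arxiv-math_0109014`), §4, p0011 L46–L60:
"**Corollary 4.4.** Suppose `V` is a finite-dimensional vector space over a finite field `k` of
characteristic `ℓ` and `G` is a subgroup of `Aut(V)` enjoying the following properties: (i) `G` is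
perfect, i.e. `G = [G, G]`; (ii) `G` contains a normal abelian subgroup `Z` such that the quotient
`Γ := G/Z` is a simple non-abelian group. (iii) There exists a positive integer `d ≥ dim_k(V)` such
that every nontrivial projective representation of `Γ` in characteristic `ℓ` has dimension `≥ d`. Then
`Z` is a cyclic central subgroup of `G` and the `G`-module `V` is very simple. **Proof.** Replacing `G`
by its minimal subgroup which maps onto `Γ` we may assume, in light of Remark 4.2 (iii), that `G` is
perfect. Now the very simplicity follows readily from Prop. 3.2 combined with Th. 4.3." — the printed
proof thus STARTS from a `G` that need not be perfect: its first sentence reduces the general case to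
the perfect one. Remark 4.2 (iii), p0010: "If `G'` is a subgroup of `G` and the `G'`-module `V` is very
simple then the `G`-module `V` is also very simple" (the tree's `IsVerySimple.of_subgroup`). §3,
proof of Proposition 3.2, Step 5, p0007 L105–L110: "let us choose a minimal subgroup `G'` of `G₃`
which maps onto `G₃/Z₃ = Γ`. Such a choice is possible in light of finiteness of `G₃`. […] The
minimality of `G'` and perfectness of `Γ` imply that `G'` is perfect."

## What is proved (theorems only)

* §1 **"its minimal subgroup which maps onto `Γ`" is perfect**
  (`exists_subgroup_map_eq_top_commutator_eq_top`): a finite group mapping onto a perfect group `Γ`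
  contains a perfect subgroup mapping onto `Γ` (g15-#1 used this argument inline in the proof of
  Proposition 3.2 (c); here it is a named lemma).
* §2 **Step 1 of Proposition 3.2 for an arbitrary commutative normal subalgebra**
  (`IsNormalSubalgebra.le_centralizer_of_isMulCommutative`): under the hypotheses of Proposition 3.2
  on the acting (perfect) group `G₀ ↠ Γ` and an irreducible `V` with `dim_k V ≤ d`, every commutative
  `G₀`-normal `A ⊂ End_k(V)` containing `ρ(ker(G₀ → Γ))` commutes with `ρ(G₀)` (g15-#1's
  `mem_centralizer_of_mem_ker` is the case `A = k[ρ(Z)]`; the same Clifford argument). This is what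
  lets the abelian `Z ⊄ G₀` of the non-perfect `G` be handled: `A = k[ρ(Z)]` is normal under
  `G ⊇ G₀`.
* §3 **Corollary 4.4 without (i)** (`corollary_4_4_of_surjective_of_not_perfect` for `θ : G ↠ Γ` with
  abelian kernel `Z`; **`zarhin2002_corollary_4_4_of_not_perfect`** for `Γ = G/Z` as printed): for
  `G ⊂ Aut(V)` (faithful `ρ`) with (ii) and (iii) and `dim_k V ≤ d` — no perfectness — `V` is very
  simple and absolutely simple, `dim_k V = d`, `ρ(Z) ⊂ k·Id`, `Z ≤ center G` and `Z` is cyclic.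
  Proof as printed: a minimal `G₀ ≤ G` mapping onto `Γ` is perfect (§1); g15-#1's Proposition 3.2 (a)
  and Corollary 4.4 for `(G₀, θ|G₀, ρ|G₀)` give very simplicity of `V` as a `G₀`-module, hence as a
  `G`-module (Remark 4.2 (iii)); the clauses on `Z` follow from §2 applied to `A = k[ρ(Z)]` and
  `End_{G₀}(V) = k·Id`.

Recorded, not formalised: Proposition 3.2 (b) and (c) genuinely need (i) — for `G = SL₃(𝔽₂) × μ₃ ⊂
GL₃(𝔽₄)` (`Z = μ₃`, `Γ = PSL₃(2)`, `ℓ = 2`, `d = 3`) the subgroup `SL₃(𝔽₂)` has index `3 < d + 1`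
and `G ↠ μ₃ ↪ PGL₂(𝔽₄)` is non-trivial.

## References

* [Zarhin2002VerySimple] Yu. G. Zarhin, *Very simple 2-adic representations and hyperelliptic
  Jacobians*, Mosc. Math. J. 2 (2002) 403–431, §4 Corollary 4.4 with proof (held text p0011
  L46–L60), Remark 4.2 (iii) (p0010), §3 proof of Proposition 3.2, Step 5 (p0007 L105–L110).
-/

namespace Literature.RepresentationTheory

open Module Function

universe u

/-! ## §1 "Its minimal subgroup which maps onto `Γ`" is perfect -/

section PerfectSubgroup

variable {G : Type*} [Group G] {Γ : Type*} [Group Γ]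

/-- **"Let us choose a minimal subgroup `G'` of `G` which maps onto `Γ`. Such a choice is possible in
light of finiteness of `G`. […] The minimality of `G'` and perfectness of `Γ` imply that `G'` is
perfect"**: a finite group `G` mapping onto a perfect group `Γ` contains a perfect subgroup `G₀`
mapping onto `Γ` (for a minimal such `G₀`, `[G₀, G₀]` still maps onto `[Γ, Γ] = Γ`).
[cite: Zarhin2002VerySimple, §3 Proposition 3.2 (proof, Step 5)]
[cite: Zarhin2002VerySimple, §4 Corollary 4.4 (proof)] -/
theorem exists_subgroup_map_eq_top_commutator_eq_top [Finite G] (θ : G →* Γ) (hθ : Surjective θ)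
    (hΓ : commutator Γ = ⊤) :
    ∃ G₀ : Subgroup G, G₀.map θ = ⊤ ∧ commutator G₀ = ⊤ := by
  classical
  haveI : Finite (Subgroup G) :=
    Finite.of_injective (fun H : Subgroup G ↦ (H : Set G)) fun _ _ h ↦ SetLike.coe_injective h
  obtain ⟨G₀, hG₀top, hG₀min⟩ := WellFounded.has_min (wellFounded_lt (α := Subgroup G))
    {H : Subgroup G | H.map θ = ⊤} ⟨⊤, by
      change (⊤ : Subgroup G).map θ = ⊤
      rw [← MonoidHom.range_eq_map, MonoidHom.range_eq_top]
      exact hθ⟩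
  change G₀.map θ = ⊤ at hG₀top
  refine ⟨G₀, hG₀top, ?_⟩
  have hCle : ⁅G₀, G₀⁆ ≤ G₀ :=
    Subgroup.commutator_le.2 fun x hx y hy ↦
      G₀.mul_mem (G₀.mul_mem (G₀.mul_mem hx hy) (G₀.inv_mem hx)) (G₀.inv_mem hy)
  have hCtop : (⁅G₀, G₀⁆ : Subgroup G).map θ = ⊤ := by
    rw [Subgroup.map_commutator, hG₀top, ← commutator_def, hΓ]
  have hCeq : ⁅G₀, G₀⁆ = G₀ := eq_of_le_of_not_lt hCle (hG₀min _ hCtop)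
  exact Group.isPerfect_def.1 (Subgroup.isPerfect_iff.2 hCeq)

end PerfectSubgroup

/-! ## §2 Step 1 of Proposition 3.2 for an arbitrary commutative normal subalgebra -/

section StepOneGeneral

variable {ℓ d : ℕ} {G : Type u} [Group G] {Γ : Type u} [Group Γ] (θ : G →* Γ)

/-- **Step 1 of Proposition 3.2, for any commutative `G`-normal `A ⊂ End_k(V)` containing `ρ(Z)`**:
under the hypotheses of Proposition 3.2 on `θ : G ↠ Γ` (perfect `G`, abelian kernel `Z`, `Γ` simple
non-abelian with `MinProjDegree ℓ d Γ`) and for an irreducible `V` with `dim_k V ≤ d`, such an `A`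
commutes with `ρ(G)`: the `r ≤ dim V ≤ d` isotypic components of the semisimple `A`-module `V` are
permuted by `G`, trivially by `Z` (as `ρ(Z) ⊂ A`); a non-trivial permutation action would give
`Γ → 𝐒_r → PGL_{r−1}(k)` against (iii); so `V` is `A`-isotypic and g15-#1's
`le_centralizer_of_isIsotypic` applies. (g15-#1's `mem_centralizer_of_mem_ker` is the case
`A = k[ρ(Z)]`.) [cite: Zarhin2002VerySimple, §3 Proposition 3.2 (proof, Step 1)] -/
theorem IsNormalSubalgebra.le_centralizer_of_isMulCommutative [IsSimpleGroup Γ]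
    (hperf : commutator G = ⊤) (hθ : Surjective θ) (hΓ : ¬ IsMulCommutative Γ)
    (hd : MinProjDegree ℓ d Γ) {k : Type u} [Field k] [Finite k] [CharP k ℓ] {V : Type u}
    [AddCommGroup V] [Module k V] [FiniteDimensional k V] {ρ : Representation k G V}
    [ρ.IsIrreducible] (hV : finrank k V ≤ d) {A : Subalgebra k (Module.End k V)}
    (hA : IsNormalSubalgebra ρ A) [IsMulCommutative A] (hZA : ∀ z ∈ θ.ker, ρ z ∈ A) :
    A ≤ Subalgebra.centralizer k (Set.range (ρ : G → Module.End k V)) := by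
  classical
  haveI : IsSemisimpleModule A V := hA.isSemisimpleModule_of_isIrreducible
  -- `Z` fixes every isotypic component
  have hZfix : θ.ker ≤ hA.isotypicComponentsPerm.ker := fun z hz ↦ by
    rw [MonoidHom.mem_ker]
    refine Equiv.ext fun c ↦ Subtype.ext ?_
    rw [IsNormalSubalgebra.coe_isotypicComponentsPerm_apply, Equiv.Perm.coe_one, id_eq]
    ext v
    rw [IsNormalSubalgebra.mem_conjSubmodule_iff]
    constructor
    · intro hv
      have := (c : Submodule A V).smul_mem ⟨ρ z, hZA z hz⟩ hv
      change ρ z (ρ z⁻¹ v) ∈ (c : Submodule A V) at this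
      rwa [Representation.self_inv_apply] at this
    · intro hv
      exact (c : Submodule A V).smul_mem ⟨ρ z⁻¹, hZA z⁻¹ (inv_mem hz)⟩ hv
  -- the permutation action is trivial, by (iii)
  haveI : Finite (isotypicComponents A V) := (isotypicComponents_finite (k := k) A).to_subtype
  have hperm : hA.isotypicComponentsPerm = 1 := by
    by_contra hne
    have h1 := hd.succ_le_card_of_perm_hom_ne_one k (commutator_eq_top_of_not_isMulCommutative hΓ)
      (descend θ hθ _ hZfix) (descend_ne_one θ hθ _ hZfix hne)
    have h2 := natCard_isotypicComponents_le_finrank (k := k) A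
    omega
  have hiso : IsIsotypic A V := hA.isIsotypic_of_isotypicComponentsPerm_eq_one hperm
  exact hA.le_centralizer_of_isIsotypic hiso hperf

end StepOneGeneral

/-! ## §3 Corollary 4.4 without the perfectness hypothesis -/

section NonPerfect

variable {ℓ d : ℕ} {G : Type u} [Group G] {Γ : Type u} [Group Γ] (θ : G →* Γ)
variable {k : Type u} [Field k] [Finite k] [CharP k ℓ] {V : Type u} [AddCommGroup V] [Module k V]
  [FiniteDimensional k V]

omit [Finite k] [FiniteDimensional k V] in
/-- Irreducibility passes from the restriction to a subgroup to the group (fewer invariant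
subspaces). [folklore] -/
private theorem isIrreducible_of_comp_subtype (ρ : Representation k G V) (H : Subgroup G)
    [h : Representation.IsIrreducible (ρ.comp H.subtype)] : ρ.IsIrreducible := by
  have hne : (⊥ : Subrepresentation (ρ.comp H.subtype)) ≠ ⊤ := bot_ne_top
  have hbt : (⊥ : Submodule k V) ≠ ⊤ := fun e ↦ hne (Subrepresentation.toSubmodule_injective e)
  haveI : Nontrivial (Subrepresentation ρ) :=
    ⟨⊥, ⊤, fun e ↦ hbt (congrArg Subrepresentation.toSubmodule e)⟩
  refine { eq_bot_or_eq_top := fun W ↦ ?_ }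
  let W' : Subrepresentation (ρ.comp H.subtype) :=
    ⟨W.toSubmodule, fun g v hv ↦ W.apply_mem_toSubmodule (g : G) hv⟩
  have hW' : W'.toSubmodule = W.toSubmodule := rfl
  rcases IsSimpleOrder.eq_bot_or_eq_top W' with h1 | h1
  · left
    have h2 : W'.toSubmodule = ⊥ := congrArg Subrepresentation.toSubmodule h1
    exact Subrepresentation.toSubmodule_injective (hW' ▸ h2)
  · right
    have h2 : W'.toSubmodule = ⊤ := congrArg Subrepresentation.toSubmodule h1
    exact Subrepresentation.toSubmodule_injective (hW' ▸ h2)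

/-- **Corollary 4.4 at the strength of its printed proof (no perfectness), for `θ : G ↠ Γ` with abelian
kernel `Z`**: if `Γ` is simple non-abelian with `MinProjDegree ℓ d Γ` and `ρ` is a faithful
representation with `dim_k V ≤ d` over a finite field of characteristic `ℓ`, then `V` is absolutely
simple and VERY SIMPLE, `dim_k V = d`, `ρ(Z) ⊂ k·Id`, `Z` is central and cyclic. "Replacing `G` by its
minimal subgroup which maps onto `Γ` we may assume […] that `G` is perfect": a perfect `G₀ ≤ G` onto
`Γ` (`exists_subgroup_map_eq_top_commutator_eq_top`), Proposition 3.2 (a) / Corollary 4.4 for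
`(G₀, θ|G₀, ρ|G₀)`, Remark 4.2 (iii) (`IsVerySimple.of_subgroup`); the clauses on `Z ⊄ G₀` by Step 1
for `A = k[ρ(Z)]`, which is normal under `G ⊇ G₀`, and `End_{G₀}(V) = k·Id`.
[cite: Zarhin2002VerySimple, §4 Corollary 4.4 (proof)] -/
theorem corollary_4_4_of_surjective_of_not_perfect [IsSimpleGroup Γ] (hθ : Surjective θ)
    (hΓ : ¬ IsMulCommutative Γ) (hZ : IsMulCommutative θ.ker) (hd : MinProjDegree ℓ d Γ)
    (ρ : Representation k G V) (hρ : Injective ρ) (hV : finrank k V ≤ d) :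
    (ρ.IsIrreducible ∧ Subalgebra.centralizer k (Set.range (ρ : G → Module.End k V)) = ⊥) ∧
      finrank k V = d ∧ θ.ker ≤ Subgroup.center G ∧
      (∀ z ∈ θ.ker, ρ z ∈ (⊥ : Subalgebra k (Module.End k V))) ∧ IsCyclic θ.ker ∧
      IsVerySimple ρ := by
  classical
  haveI : Finite (Module.End k V) := Module.finite_of_finite k
  haveI : Finite G := Finite.of_injective ρ hρ
  -- "its minimal subgroup which maps onto `Γ`": a perfect `G₀ ≤ G` onto `Γ`
  obtain ⟨G₀, hG₀top, hG₀perf⟩ := exists_subgroup_map_eq_top_commutator_eq_top θ hθ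
    (commutator_eq_top_of_not_isMulCommutative hΓ)
  let θ₀ : G₀ →* Γ := θ.comp G₀.subtype
  have hθ₀ : Surjective θ₀ := fun γ ↦ by
    have hγ : γ ∈ G₀.map θ := hG₀top ▸ Subgroup.mem_top γ
    obtain ⟨g, hg, rfl⟩ := hγ
    exact ⟨⟨g, hg⟩, rfl⟩
  have hker₀ : ∀ g : G₀, g ∈ θ₀.ker ↔ (g : G) ∈ θ.ker := fun g ↦ Iff.rfl
  have hZ₀ : IsMulCommutative θ₀.ker := ⟨⟨fun x y ↦ by
    have := hZ.is_comm.comm ⟨((x : G₀) : G), (hker₀ _).1 x.2⟩ ⟨((y : G₀) : G), (hker₀ _).1 y.2⟩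
    have h' : ((x : G₀) : G) * ((y : G₀) : G) = ((y : G₀) : G) * ((x : G₀) : G) :=
      congrArg Subtype.val this
    have h'' : (x : G₀) * (y : G₀) = (y : G₀) * (x : G₀) := Subtype.ext h'
    exact Subtype.ext h''⟩⟩
  let ρ₀ : Representation k G₀ V := ρ.comp G₀.subtype
  have hρ₀ : Injective ρ₀ := fun x y hxy ↦ Subtype.ext (hρ hxy)
  -- Proposition 3.2 (a) and Corollary 4.4 for `G₀`
  obtain ⟨hirr₀, hcomm₀, hdim, -, -, -, -⟩ :=
    proposition_3_2_a_of_surjective θ₀ hG₀perf hθ₀ hΓ hZ₀ hd ρ₀ hρ₀ hV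
  obtain ⟨-, -, hvs₀⟩ := corollary_4_4_of_surjective θ₀ hG₀perf hθ₀ hΓ hZ₀ hd ρ₀ hρ₀ hV
  haveI := hirr₀
  -- Remark 4.2 (iii)
  have hvs : IsVerySimple ρ := IsVerySimple.of_subgroup G₀ hvs₀
  have hirr : ρ.IsIrreducible := isIrreducible_of_comp_subtype ρ G₀
  -- `End_G(V) ⊂ End_{G₀}(V) = k·Id`
  have hcomm : Subalgebra.centralizer k (Set.range (ρ : G → Module.End k V)) = ⊥ := by
    refine le_antisymm ?_ bot_le
    rw [← hcomm₀]
    apply Subalgebra.centralizer_le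
    rintro _ ⟨g, rfl⟩
    exact ⟨(g : G), rfl⟩
  -- `Z` acts by scalars: Step 1 for `A = k[ρ(Z)]`, normal under `G ⊇ G₀`, and `End_{G₀}(V) = k·Id`
  have hZs : ∀ z ∈ θ.ker, ρ z ∈ (⊥ : Subalgebra k (Module.End k V)) := by
    set A := Algebra.adjoin k ((ρ : G → Module.End k V) '' θ.ker) with hA_def
    have hA : IsNormalSubalgebra ρ A := isNormalSubalgebra_adjoin_image_of_normal ρ θ.ker
    have hA₀ : IsNormalSubalgebra ρ₀ A := hA.comp G₀.subtype
    haveI : IsMulCommutative A := Algebra.isMulCommutative_adjoin k (by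
      rintro _ ⟨x, hx, rfl⟩ _ ⟨y, hy, rfl⟩
      change ρ x * ρ y = ρ y * ρ x
      rw [← map_mul, ← map_mul]
      exact congrArg ρ (congrArg Subtype.val (hZ.is_comm.comm ⟨x, hx⟩ ⟨y, hy⟩)))
    have hZA : ∀ z ∈ θ₀.ker, ρ₀ z ∈ A := fun z hz ↦
      Algebra.subset_adjoin ⟨(z : G), (hker₀ z).1 hz, rfl⟩
    have hle := hA₀.le_centralizer_of_isMulCommutative θ₀ hG₀perf hθ₀ hΓ hd hV hZA
    rw [hcomm₀] at hle
    intro z hz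
    exact hle (Algebra.subset_adjoin ⟨z, hz, rfl⟩)
  -- `Z` is central and cyclic
  haveI : Nontrivial V := hvs.nontrivial
  have hcenter : θ.ker ≤ Subgroup.center G := fun z hz ↦ by
    obtain ⟨c, hc⟩ := Algebra.mem_bot.1 (hZs z hz)
    rw [Subgroup.mem_center_iff]
    intro g
    apply hρ
    rw [map_mul, map_mul, ← hc]
    exact (Algebra.commutes c (ρ g)).symm
  obtain ⟨f, hf⟩ := exists_monoidHom_injective_of_forall_mem_bot ρ hρ θ.ker hZs
  haveI : Finite θ.ker := Finite.of_injective f hf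
  exact ⟨⟨hirr, hcomm⟩, hdim, hcenter, hZs, isCyclic_of_injective_ringHom f hf, hvs⟩

/-- **Corollary 4.4 (Zarhin 2002) without hypothesis (i), as its printed proof allows.** "Suppose `V`
is a finite-dimensional vector space over a finite field `k` of characteristic `ℓ` and `G` is a
subgroup of `Aut(V)`" such that "(ii) `G` contains a normal abelian subgroup `Z` such that the quotient
`Γ := G/Z` is a simple non-abelian group. (iii) There exists a positive integer `d ≥ dim_k(V)` such
that every nontrivial projective representation of `Γ` in characteristic `ℓ` has dimension `≥ d`. Then
`Z` is a cyclic central subgroup of `G` and the `G`-module `V` is very simple" — and moreover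
absolutely simple of dimension `d` with `ρ(Z) ⊂ k·Id`; "(i) `G` is perfect" is NOT assumed ("Replacing
`G` by its minimal subgroup which maps onto `Γ` we may assume […] that `G` is perfect").
[cite: Zarhin2002VerySimple, §4 Corollary 4.4 (proof)] -/
theorem zarhin2002_corollary_4_4_of_not_perfect (Z : Subgroup G) [Z.Normal] [IsSimpleGroup (G ⧸ Z)]
    (hΓ : ¬ IsMulCommutative (G ⧸ Z)) (hZ : IsMulCommutative Z) (hd : MinProjDegree ℓ d (G ⧸ Z))
    (ρ : Representation k G V) (hρ : Injective ρ) (hV : finrank k V ≤ d) :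
    (ρ.IsIrreducible ∧ Subalgebra.centralizer k (Set.range (ρ : G → Module.End k V)) = ⊥) ∧
      finrank k V = d ∧ Z ≤ Subgroup.center G ∧
      (∀ z ∈ Z, ρ z ∈ (⊥ : Subalgebra k (Module.End k V))) ∧ IsCyclic Z ∧ IsVerySimple ρ := by
  have hZ' : IsMulCommutative (QuotientGroup.mk' Z).ker := by
    rw [QuotientGroup.ker_mk']
    exact hZ
  have h := corollary_4_4_of_surjective_of_not_perfect (QuotientGroup.mk' Z)
    (QuotientGroup.mk'_surjective Z) hΓ hZ' hd ρ hρ hV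
  rw [QuotientGroup.ker_mk'] at h
  exact h

end NonPerfect

end Literature.RepresentationTheory
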